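import Literature.MathematicalPhysics.QuantumFieldTheory.Balaban1983to89.B9Thm313WholeDvFromDds
import Literature.MathematicalPhysics.QuantumFieldTheory.Balaban1983to89.B9Thm312WholeStepDirFrom3131

/-!
# `Balaban1983to89.B9Thm33G0DirXHolderFromDds` — [B9] Theorems 3.12–3.13 (pp. 421–426): THE HÖLDER PROBE OF THE MIXED MEMBER
# Φ^X_β∘∇_{U,ν}∘G₀∘D_U (`Thm33G0DirX.pXdDH`) IS THEOREM 3.3's (3.45) FOR G₀ PER DIRECTION PAIR, COMPOSED WITH THE KINEMATIC
# DECOMPOSITION D_U = Σ_μ ∇*_{U,μ}∘J_μ AND ONE HÖLDER LETTER FOR J_μ — the last displayed field of the W-c face `hX` reduced to ONE interface letter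

T. Bałaban, *Propagators for lattice gauge theories in a background field*, Commun. Math. Phys. **99** (1985) 389–434
[`Balaban1985BackgroundPropagators`, "B9"]; [4] = T. Bałaban, *Propagators and renormalization transformations for lattice gauge
theories. II*, Commun. Math. Phys. **96** (1984) 223–250 [`Balaban1984PropagatorsII`].

statement-level skeleton of published theorems with citation tags; proofs where landed; nothing here is a claim about the Yang–Mills
mass gap

THE PRINTED LOCUS (held text `paper:balaban1985-cmp99-background-propagators`, pp. 397–398 and 421–423 re-read).  (3.45) p. 398: *"‖ζ∇_UG′(U)∇\*_Uλ‖_β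
≦ B′₀(ε,β)(Lʲη)^{−β}(‖ζ‖^ξ_β + |ζ|)e^{−δ₀d(y,y′)}(‖λ‖^{ξ′}_{β+ε} + |λ|) for 0 < ε ≦ 1, 0 ≦ β < 1, supp λ ⊂ Δ̃(y′), y′ ∈ Λ_{j′}, ξ′ = L^{j′}η"*
(B′₀(ε,β) → ∞ if ε → 0 or β → 1); Theorem 3.3 p. 399 (*"the operator G(U) (a = 1) satisfies the inequalities (3.42)–(3.47)"*); p. 398: *"the choice of
derivatives ∇_U, ∇\*_U is conventional, we may always replace ∇_U by ∇\*_U, and vice versa, in arbitrary place and combination. … Using Lemma 2.1 in [4]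
we may replace the factor (Lʲη)^α by (Lʲη)^β(L^{j′}η)^γ with β + γ = α"*; (3.3) p. 390 (the covariant gradient D_U of a scalar: a vector function whose
μ-component is ∇_{U,μ}λ = −∇\*_{U,μ} of one transported neighbour value); p. 421: *"One of the three derivatives there has to be applied either to an
expression on the right, or on the left, of Δ′_π"*; p. 422: *"This inequality [(3.131)] and Theorem 3.3 for G₀ imply a convergence of the series (3.130)
… in all norms appearing on the left-hand sides of the inequalities (3.42)–(3.47)"*; [4] (2.51)–(2.56) pp. 232–233, Lemma 2.1 (2.60)–(2.61) p. 234.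

THE POINT.  The N06 certificate (editions 26–30, `…N06AtOpsYNuOfRecordV6EPairNG…NK`) displays the W-c face
`hX : Thm33G0DirX (𝔬12 x) (𝔭A x) (𝔡A x).Dd 1 (H x) _ (bH13 x) Bx0 BdX δ12₀ δ12₃ U` (`B9Thm312WholeStepDirFrom3131` §1): two Theorem-3.3-type
X-probe members of G₀.  Its zeroth-order field `pX0` was supplied at the cut probe carrier (`B9Thm33G0ProbeZeroAtCutPins.pX0_of_pins`).  The other
field, `pXdDH ν β` — the probe Φ^X_β∘∇_{U,ν}∘G₀∘D_U out of the scalar Hölder class `bH13` into 𝔠_P^{(β−1)} — is a (3.45)-TYPE member (a Hölder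
SOURCE, not a sharp block), so it is NOT an interpolate of kernel bounds.  But it belongs to the D_U-right orbit of `B9Thm313WholeDvFromDds`: with
the kinematic decomposition D_U = Σ_μ ∇\*_{U,μ}∘J_μ (there, `comp_dv_eq_fsum`; at node00-def-Y's pins `B9GradViaDivLettersAtPins.DvcoKH_eq_sum`),
  Φ^X_β∘∇_{U,ν}∘G₀∘D_U = Σ_μ (Φ^X_β∘∇_{U,ν}∘G₀∘∇\*_{U,μ})∘J_μ,
and the summand's first factor IS Theorem 3.3's (3.45) for G₀ per direction pair — the field `Thm33G0Dir.h45m (ν, μ) ε β`, which the certificate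
DERIVES from rows 19 (`B9Thm312WholeFromThm310.thm33G0Dir_of_conv3107`, output of `…N06G0LayerFromThm310AtPinsE.g0_layer_of_thm310_coreB`) with
the bond input class `bHXA x (β + ε)`.  So `pXdDH` follows from DERIVED material plus ONE letter on the kinematic operator J_μ: its majorant from
the scalar class `bH13` into the bond input class at the exponent β + ε, WITH ONE LENGTH (the orbit's scalar sources carry one power of the scale,
cf. `Letters313Z.gD2 : 𝔠_W⁽¹⁾ → 𝔠⁽²⁾`):  `hJ : HasMaj bH (bHX (β + ε)) (J μ) (C_J·(Lʲη)·e^{−δ_J d})`.  THIS FILE types that reduction, generic in the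
letters exactly as `B9Thm313WholeDvFromDds.pXDv_of_h43Rd` ∕ `gD2_of_e2d`:
* §0 weight moves (`hasMaj_weightNorm_target`, `hasMaj_lenInv_of_len`, ★ `hasMaj_len_of_lenInvSource` — a no-length letter read from the source
  rescaled by (L^{j′}η)⁻¹ gains the output length, one transfer) and ★ `hasMaj_cNormR_of_ofBlocks_rpow_lenInv` — a (3.45)-shape majorant
  `B·(Lʲη)^{−β}·e^{−rd}` into the sharp probe blocks, read from the source class with the weight (L^{j′}η)⁻¹, IS the majorant `B·L·e^{−(r−αδ)d}` into
  𝔠_P^{(β−1)}: the input power moved to the output by p. 398's transfer ([4] (2.60) through n06-k's member facts `Facts347`, `scaleTransfer_len_rpow`);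
* §1 ★★ `pXdDH_of_h45m` — ONE β, ONE ν: `HasMaj bH (cNormR R₀ H₀ blkPX _ (β − 1)) ((Φ ∘ₗ Ddν ∘ₗ G0) ∘ₗ Dv) (BdX·e^{−δ₃d})` from the directional (3.45)
  members `h45 μ` (input class `bHX`, constant `Bi2`, rate `δ₀`), `hDv : Dv = Σ_μ Dds μ ∘ₗ J μ`, `hJ μ` (constant `C_J`, rate `δ_J`, one length) —
  `BdX ≥ |P|·κ·Bi2·L₀·C_J·c` (κ = the cutting cost of `bHX`, c the [4] (2.61) row-sum constant at the margin σ), `0 ≤ δ₃ ≤ δ₀ − αδ`, `δ₃ + σ ≤ δ_J`;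
  ★★ `pXdDH_of_h45m_noLen` — the same from a NO-LENGTH J-letter `C_J·e^{−δ_J d}` out of a flat site class `b_W`, the scalar source read as `b_W`
  rescaled by (Lʲη)⁻¹ (the supplier∕consumer adapter: the one length lives in the pin of `bH13`);
* §2 ★★ `pXdDH_of_thm33G0Dir` — the FIELD SHAPE `∀ ν β, 0 ≤ β → β < 1 → …` of `Thm33G0DirX.pXdDH` from the schema `Thm33G0Dir 𝔬 𝔭 Dd Dds R₀ H₀ bHX B₀ Bh
  Bi Bi2 δ₀ U` (its `h45m`), an exponent schedule `ε : ℝ → ℝ` (0 < ε β ≤ 1) and the J-letters into `bHX (β + ε β)`; ★ `pXdDH_of_thm33G0Dir_one` — the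
  schedule ε β = 1 − β (J read at the single input exponent 1); ★★ `pXdDH_of_thm33G0Dir_noLen` (no-length J-letters, source `b_W` rescaled by
  (Lʲη)⁻¹); ★★ `thm33G0DirX_of_thm33G0Dir` — the whole face `Thm33G0DirX` from `pX0` (supplied
  elsewhere) and the above.

LOCATED REMARK X1 (schema shape, recorded for the knit owner; not a claim).  `pXdDH` quantifies over ALL β ∈ [0,1) out of ONE source norm `bH13`,
while (3.45) reads the source at the exponent β + ε: whatever schedule ε(β) is chosen, the J-letters `hJ β` must map `bH13` into `bHX (β + ε β)` for
every β < 1 — at ε β = 1 − β into the single class `bHX 1`.  This is the same single-letter artefact as `B9Thm312WholeStepDirFrom3131`'s REMARK U2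
(β-uniform θ_H); it constrains the PRODUCER side of `bH13` (`Letters3131H.tbH ∕ tb₂H`: T_b, T_b₂ : 𝔠⁽²⁾ → bH13) and is the knit owner's to weigh.
LOCATED REMARK X2 (the interface, not typed here).  The J-letter is the located question «INPUT-HÖLDER-TRANSPORT» of dag-n06-l (pub-ymgap bus
2026-08-28 07:51Z): at the FLAT coordinate input norms `bHK ∕ bHS` (`B9CoReadingCoordsInput(S)`) the Hölder part of J_μλ carries ‖U_μ(s) − U_μ(s′)‖,
not controlled by (3.35) in a rough gauge; at transported norms (print's (3.40)) J_μ is bounded up to the plaquette holonomy.  Either way the letter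
`hJ` below is the ONE interface `hX.pXdDH` waits on; this file asserts nothing about it.

HONEST SCOPE.  Kernel-checked bookkeeping over FREE finite carriers, block maps and letters: (3.45) for G₀ per direction pair (`h45` ∕ `Thm33G0Dir`), the
kinematic decomposition `hDv`, the J-letters `hJ`, [4] Lemma 2.1 (`RowSum`) and the member facts (`Facts347`) are HYPOTHESES; nothing of [B9] or [4] is
asserted and NO new hypothesis species is introduced at the certificate (the J-letter is the interface named by `B9Thm313WholeDvFromDds`).  COUNT-NEUTRAL;
`hX` NOT discharged by this file alone; N06 NOT discharged; one finite lattice at a time; nothing continuum, nothing about the mass gap.  Cell `pub-ymgap`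
(HUMAN RULING D-0062), Track A node N06 [B9], W-c face `hX` (dag-lead WIDTH-209 piece 1, DEDUP-381), seat `pub-ymgap-dag-n06-w6` (g0′), 2026-08-28.
NEW file; nothing landed is modified.
-/

namespace Literature.MathematicalPhysics.QuantumFieldTheory.Balaban1983to89.B9Thm33G0DirXHolderFromDds

open Literature.MathematicalPhysics.QuantumFieldTheory.Balaban1983to89
open Finset B6RandomWalk B6RandomWalkHom B9Thm34Ext B11SectG B9SectDSup B9Thm312Whole B9Thm312WholeClasses
open B9RWSums343Holder B9RWSums343to347Whole B9RWSums346Schur B9Ineq347 B9PerturbationMajorantAlgebra B9Thm313WholeDvFromDds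
open B9Thm312WholeDir B9Thm312WholeStepDirFrom3131

noncomputable section

variable {g : B9.Geometry} {X W P PX : Type} [Fintype P] [Fintype PX] [Fintype g.Site]
variable {R₀ : ℝ} {H₀ : Prop}

/-! ## §0 Weight moves and the p. 398 transfer for a (3.45)-shape majorant read from a weighted source -/

/-- Moving a weight into the TARGET of a majorant: if T : b₁ → b₂ has the majorant K and W(y)·K(y,y′) ≦ K′(y,y′), then T : b₁ → (b₂ rescaled by W) has K′
(the exact half of p. 398's remark *"the choice of powers Lʲη is conventional"*; cf. `B9SectDSup.HasMaj.weight` for both sides rescaled).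
[cite: Balaban1985BackgroundPropagators, p.398 (remark after (3.47)); Balaban1984PropagatorsII, (2.51) p.232] -/
theorem hasMaj_weightNorm_target {F₁ F₂ : Type} [AddCommGroup F₁] [Module ℝ F₁] [AddCommGroup F₂] [Module ℝ F₂]
    {b₁ : BlockNorm (toB6 g R₀ H₀) F₁} {b₂ : BlockNorm (toB6 g R₀ H₀) F₂} {T : F₁ →ₗ[ℝ] F₂} {K K' : g.Site → g.Site → ℝ}
    {Wt : g.Site → ℝ} (hW : ∀ y, 0 ≤ Wt y) (h : HasMaj b₁ b₂ T K) (hKK' : ∀ y y', Wt y * K y y' ≤ K' y y') :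
    HasMaj b₁ (weightNorm b₂ Wt hW) T K' := by
  intro y' μ hμ y
  rw [weightNorm_loc]
  calc Wt y * b₂.loc y (T μ) ≤ Wt y * (K y y' * b₁.loc y' μ) := mul_le_mul_of_nonneg_left (h y' μ hμ y) (hW y)
    _ = (Wt y * K y y') * b₁.loc y' μ := by ring
    _ ≤ K' y y' * b₁.loc y' μ := mul_le_mul_of_nonneg_right (hKK' y y') (b₁.loc_nonneg y' μ)

/-- **THE ONE LENGTH OF A J-LETTER MOVED INTO ITS TARGET**: a majorant C·(Lʲη)·e^{−rd} of J from the scalar class into the bond input class (the power at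
the OUTPUT block) is the majorant C·e^{−rd} into the bond input class rescaled by (Lʲη)⁻¹.
[cite: Balaban1985BackgroundPropagators, p.398 (remark after (3.47)) + (3.3) p.390; Balaban1984PropagatorsII, (2.51) p.232] -/
theorem hasMaj_lenInv_of_len (hG : GeoOK g) {F₁ F₂ : Type} [AddCommGroup F₁] [Module ℝ F₁] [AddCommGroup F₂] [Module ℝ F₂]
    {b₁ : BlockNorm (toB6 g R₀ H₀) F₁} {b₂ : BlockNorm (toB6 g R₀ H₀) F₂} {J : F₁ →ₗ[ℝ] F₂} {C r : ℝ}
    (h : HasMaj b₁ b₂ J (fun a b => C * g.len a * Real.exp (-(r * g.dist a b)))) :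
    HasMaj b₁ (weightNorm b₂ (fun y => (g.len y)⁻¹) (fun y => inv_nonneg.mpr (hG.lenle y))) J
      (fun a b => C * Real.exp (-(r * g.dist a b))) := by
  refine hasMaj_weightNorm_target (fun y => inv_nonneg.mpr (hG.lenle y)) h fun y y' => le_of_eq ?_
  have hl0 : g.len y ≠ 0 := (hG.lenpos y).ne'
  calc (g.len y)⁻¹ * (C * g.len y * Real.exp (-(r * g.dist y y')))
      = ((g.len y)⁻¹ * g.len y) * (C * Real.exp (-(r * g.dist y y'))) := by ring
    _ = C * Real.exp (-(r * g.dist y y')) := by rw [inv_mul_cancel₀ hl0, one_mul]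

/-- ★ **A (3.45)-SHAPE MAJORANT READ FROM THE SOURCE CLASS RESCALED BY (L^{j′}η)⁻¹ IS A MAJORANT INTO 𝔠_P^{(β−1)}, ONE TRANSFER**: if T has the [4]-(2.51)
majorant `B·(Lʲη)^{−β}·e^{−rd(y,y′)}` from a block norm `b` of bond functions into the sharp probe blocks (print's (3.45): the factor (Lʲη)^{−β} at the
OUTPUT scale), then from `b` rescaled by (L^{j′}η)⁻¹ (the INPUT scale) into 𝔠_P^{(β−1)} it has `B·L·e^{−(r−αδ)d}` — the ratio L^{j′}η ∕ Lʲη costs L·e^{αδd}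
([4] (2.60) in the form of the member facts, `B9RWSums346Schur.scaleTransfer_len_rpow` at γ = 1).
[cite: Balaban1985BackgroundPropagators, (3.45) p.398 + p.398 (remark after (3.47)); Balaban1984PropagatorsII, (2.51) p.232 + Lemma 2.1 (2.60) p.234] -/
theorem hasMaj_cNormR_of_ofBlocks_rpow_lenInv (hG : GeoOK g) {dF : ℕ} {δ α L₀ : ℝ} (hF : Facts347 g R₀ H₀ dF δ α L₀)
    {b : BlockNorm (toB6 g R₀ H₀) (X → ℝ)} {blkPX : PX → g.Site} {T : (X → ℝ) →ₗ[ℝ] (PX → ℝ)} {B β r : ℝ} (hB : 0 ≤ B)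
    (h : HasMaj b (BlockNorm.ofBlocks (toB6 g R₀ H₀) blkPX) T
      (fun a b => B * g.len a ^ (-β) * Real.exp (-(r * g.dist a b)))) :
    HasMaj (weightNorm b (fun y => (g.len y)⁻¹) (fun y => inv_nonneg.mpr (hG.lenle y))) (cNormR R₀ H₀ blkPX hG.lenle (β - 1)) T
      (fun a b => B * g.L * Real.exp (-((r - α * δ) * g.dist a b))) := by
  intro y' μ hμ y
  have hb := h y' μ hμ y
  rw [cNormR_loc, weightNorm_loc]
  set N := (BlockNorm.ofBlocks (toB6 g R₀ H₀) blkPX).loc y (T μ) with hN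
  set N' := b.loc y' μ with hN'
  have hN'0 : 0 ≤ N' := b.loc_nonneg y' μ
  have hly : 0 < g.len y := hG.lenpos y
  have hly' : 0 < g.len y' := hG.lenpos y'
  -- (Lʲη)^{β−1}·(Lʲη)^{−β} = (Lʲη)⁻¹
  have hpow : g.len y ^ (β - 1) * g.len y ^ (-β) = (g.len y)⁻¹ := by
    rw [← Real.rpow_add hly, show β - 1 + -β = (-1 : ℝ) by ring, Real.rpow_neg_one]
  -- the transfer at γ = 1: e^{−αδd(y,y′)}·L^{j′}η ≦ L·Lʲη, i.e. (Lʲη)⁻¹·e^{−αδd} ≦ L·(L^{j′}η)⁻¹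
  have hst : (g.len y)⁻¹ * Real.exp (-(α * δ * g.dist y y')) ≤ g.L * (g.len y')⁻¹ := by
    have h1 := scaleTransfer_len_rpow hF 1 (by norm_num) y y'
    simp only [abs_one, Real.rpow_one] at h1
    -- h1 : e^{−αδd(y,y′)}·len y′ ≦ L·len y
    rw [inv_mul_le_iff₀ hly, ← mul_assoc, le_mul_inv_iff₀ hly']
    calc Real.exp (-(α * δ * g.dist y y')) * g.len y' ≤ g.L * g.len y := h1
      _ = g.len y * g.L := mul_comm _ _
  have hsplit : Real.exp (-(r * g.dist y y')) =
      Real.exp (-((r - α * δ) * g.dist y y')) * Real.exp (-(α * δ * g.dist y y')) := by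
    rw [← Real.exp_add]; congr 1; ring
  have hE : 0 ≤ B * Real.exp (-((r - α * δ) * g.dist y y')) := mul_nonneg hB (Real.exp_nonneg _)
  have hβ1 : 0 ≤ g.len y ^ (β - 1) := Real.rpow_nonneg hly.le _
  calc g.len y ^ (β - 1) * N ≤ g.len y ^ (β - 1) * (B * g.len y ^ (-β) * Real.exp (-(r * g.dist y y')) * N') :=
        mul_le_mul_of_nonneg_left hb hβ1
    _ = B * (g.len y ^ (β - 1) * g.len y ^ (-β)) * Real.exp (-(r * g.dist y y')) * N' := by ring
    _ = B * Real.exp (-((r - α * δ) * g.dist y y')) * ((g.len y)⁻¹ * Real.exp (-(α * δ * g.dist y y'))) * N' := by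
        rw [hpow, hsplit]; ring
    _ ≤ B * Real.exp (-((r - α * δ) * g.dist y y')) * (g.L * (g.len y')⁻¹) * N' :=
        mul_le_mul_of_nonneg_right (mul_le_mul_of_nonneg_left hst hE) hN'0
    _ = B * g.L * Real.exp (-((r - α * δ) * g.dist y y')) * ((g.len y')⁻¹ * N') := by ring

/-- ★ **A J-LETTER WITHOUT LENGTH, READ FROM THE SOURCE RESCALED BY (L^{j′}η)⁻¹, GAINS THE OUTPUT LENGTH**: if J : b_W → b₂ has the majorant
`C·e^{−rd(y,y′)}` (the natural shape of a kinematic letter between flat input classes at one exponent), then from `b_W` rescaled by (L^{j′}η)⁻¹ it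
has `C·L·(Lʲη)·e^{−(r−αδ)d}` — the input length written at the output block by p. 398's transfer ([4] (2.60), `scaleTransfer_len_rpow` at γ = 1).
This is the adapter between a supplier's no-length J-letter and the with-length letter `hJ` of `pXdDH_of_h45m` (the one length then lives in the
PIN of the scalar class, `bH13 := b_W rescaled by (Lʲη)⁻¹`). [cite: Balaban1985BackgroundPropagators, p.398 (remark after (3.47)) + (3.3) p.390; Balaban1984PropagatorsII, (2.51) p.232 + Lemma 2.1 (2.60) p.234] -/
theorem hasMaj_len_of_lenInvSource (hG : GeoOK g) {dF : ℕ} {δ α L₀ : ℝ} (hF : Facts347 g R₀ H₀ dF δ α L₀)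
    {F₂ : Type} [AddCommGroup F₂] [Module ℝ F₂]
    {bW : BlockNorm (toB6 g R₀ H₀) (W → ℝ)} {b₂ : BlockNorm (toB6 g R₀ H₀) F₂} {J : (W → ℝ) →ₗ[ℝ] F₂} {C r : ℝ} (hC : 0 ≤ C)
    (h : HasMaj bW b₂ J (fun a b => C * Real.exp (-(r * g.dist a b)))) :
    HasMaj (weightNorm bW (fun y => (g.len y)⁻¹) (fun y => inv_nonneg.mpr (hG.lenle y))) b₂ J
      (fun a b => C * g.L * g.len a * Real.exp (-((r - α * δ) * g.dist a b))) := by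
  intro y' μ hμ y
  have hb := h y' μ hμ y
  rw [weightNorm_loc]
  set N' := bW.loc y' μ with hN'
  have hN'0 : 0 ≤ N' := bW.loc_nonneg y' μ
  have hly' : 0 < g.len y' := hG.lenpos y'
  -- the transfer at γ = 1: e^{−αδd(y,y′)}·L^{j′}η ≦ L·Lʲη
  have hst : Real.exp (-(α * δ * g.dist y y')) * g.len y' ≤ g.L * g.len y := by
    have h1 := scaleTransfer_len_rpow hF 1 (by norm_num) y y'
    simpa only [abs_one, Real.rpow_one] using h1
  have hsplit : Real.exp (-(r * g.dist y y')) =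
      Real.exp (-((r - α * δ) * g.dist y y')) * Real.exp (-(α * δ * g.dist y y')) := by
    rw [← Real.exp_add]; congr 1; ring
  have hone : g.len y' * (g.len y')⁻¹ = 1 := mul_inv_cancel₀ hly'.ne'
  have hE : 0 ≤ C * Real.exp (-((r - α * δ) * g.dist y y')) := mul_nonneg hC (Real.exp_nonneg _)
  have hW0 : 0 ≤ (g.len y')⁻¹ * N' := mul_nonneg (inv_nonneg.mpr hly'.le) hN'0
  calc b₂.loc y (J μ) ≤ C * Real.exp (-(r * g.dist y y')) * N' := hb
    _ = C * Real.exp (-((r - α * δ) * g.dist y y')) * (Real.exp (-(α * δ * g.dist y y')) * g.len y') *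
          ((g.len y')⁻¹ * N') := by
        rw [hsplit]
        calc C * (Real.exp (-((r - α * δ) * g.dist y y')) * Real.exp (-(α * δ * g.dist y y'))) * N'
            = C * (Real.exp (-((r - α * δ) * g.dist y y')) * Real.exp (-(α * δ * g.dist y y'))) *
                (g.len y' * (g.len y')⁻¹) * N' := by rw [hone, mul_one]
          _ = _ := by ring
    _ ≤ C * Real.exp (-((r - α * δ) * g.dist y y')) * (g.L * g.len y) * ((g.len y')⁻¹ * N') :=
        mul_le_mul_of_nonneg_right (mul_le_mul_of_nonneg_left hst hE) hW0
    _ = C * g.L * g.len y * Real.exp (-((r - α * δ) * g.dist y y')) * ((g.len y')⁻¹ * N') := by ring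

/-! ## §1 ★★ The mixed Hölder probe member from (3.45) per direction pair, the kinematic decomposition and one J-letter -/

/-- ★★ **Φ^X_β∘∇_{U,ν}∘G₀∘D_U OUT OF A SCALAR CLASS INTO 𝔠_P^{(β−1)} (the shape of `Thm33G0DirX.pXdDH ν β`) FROM THEOREM 3.3's (3.45) FOR G₀ PER DIRECTION
PAIR, D_U = Σ_μ ∇\*_{U,μ}∘J_μ AND ONE J-LETTER**.  For one ν and one β: if every Φ∘∇_ν∘G₀∘∇\*_{U,μ} has the (3.45) majorant `Bi2·(Lʲη)^{−β}·e^{−δ₀d}` from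
the bond input class `bHX` into the sharp probe blocks (`h45` = `Thm33G0Dir.h45m (ν, μ) ε β` at the chosen ε), D_U decomposes through the kinematic
letters J_μ (`hDv`), and each J_μ maps the scalar class `bH` into `bHX` with the majorant `C_J·(Lʲη)·e^{−δ_J d}` (`hJ`, one length), then
Φ∘∇_ν∘G₀∘D_U : bH → 𝔠_P^{(β−1)} has `BdX·e^{−δ₃d}` for any `BdX ≥ |P|·(κ·(Bi2·L₀)·C_J·c)` (κ = the cutting cost of `bHX`, c the row-sum constant at the
margin σ, L ≦ L₀) and any rate `0 ≤ δ₃ ≤ δ₀ − αδ`, `δ₃ + σ ≤ δ_J` — one composition ([4] (2.54) + (2.61), the margin spent on J_μ), one transfer (p. 398),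
one sum over μ. [cite: Balaban1985BackgroundPropagators, Thm 3.3 (3.45) p.398 + p.398 (remarks after (3.47)) + (3.3) p.390 + pp.421–423; Balaban1984PropagatorsII, (2.51)–(2.56) pp.232–233 + Lemma 2.1 (2.60)–(2.61) p.234] -/
theorem pXdDH_of_h45m (hG : GeoOK g) {σ c : ℝ} (hrow : RowSum (toB6 g R₀ H₀) σ c) {dF : ℕ} {δ α L₀ : ℝ}
    (hF : Facts347 g R₀ H₀ dF δ α L₀)
    {bH : BlockNorm (toB6 g R₀ H₀) (W → ℝ)} {bHX : BlockNorm (toB6 g R₀ H₀) (X → ℝ)} {blkPX : PX → g.Site}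
    {G0 Ddν : Module.End ℝ (X → ℝ)} {Dds : P → Module.End ℝ (X → ℝ)} {Φ : (X → ℝ) →ₗ[ℝ] (PX → ℝ)}
    {J : P → (W → ℝ) →ₗ[ℝ] (X → ℝ)} {Dv : (W → ℝ) →ₗ[ℝ] (X → ℝ)} {β Bi2 δ₀ CJ δJ κ₀ BdX δ₃ : ℝ}
    (hBi2 : 0 ≤ Bi2) (hCJ : 0 ≤ CJ) (hc : 0 ≤ c) (hκ : bHX.κ ≤ κ₀)
    (hδ₃ : 0 ≤ δ₃) (hδ₃0 : δ₃ ≤ δ₀ - α * δ) (hδ₃J : δ₃ + σ ≤ δJ)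
    (hBdX : (Fintype.card P : ℝ) * (κ₀ * (Bi2 * L₀) * CJ * c) ≤ BdX)
    (hDv : Dv = ∑ μ, Dds μ ∘ₗ J μ)
    (h45 : ∀ μ, HasMaj bHX (BlockNorm.ofBlocks (toB6 g R₀ H₀) blkPX) (Φ ∘ₗ (Ddν ∘ₗ (G0 ∘ₗ Dds μ)))
      (fun a b => Bi2 * g.len a ^ (-β) * Real.exp (-(δ₀ * g.dist a b))))
    (hJ : ∀ μ, HasMaj bH bHX (J μ) (fun a b => CJ * g.len a * Real.exp (-(δJ * g.dist a b)))) :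
    HasMaj bH (cNormR R₀ H₀ blkPX hG.lenle (β - 1)) ((Φ ∘ₗ Ddν ∘ₗ G0) ∘ₗ Dv)
      (fun a b => BdX * Real.exp (-(δ₃ * g.dist a b))) := by
  have htri : Triangle254 (toB6 g R₀ H₀) := fun a b c => hG.tri a b c
  have hsym : DistSymm (toB6 g R₀ H₀) := fun a b => hG.symm a b
  have hL0 : 0 ≤ g.L := le_trans zero_le_one hF.one_le_L
  have hL₀ : g.L ≤ L₀ := hF.L_le
  -- the bond input class rescaled by (L^{j′}η)⁻¹: the middle space of the composition
  set bM : BlockNorm (toB6 g R₀ H₀) (X → ℝ) := weightNorm bHX (fun y => (g.len y)⁻¹) (fun y => inv_nonneg.mpr (hG.lenle y)) with hbM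
  -- each Φ∘∇_ν∘G₀∘∇*_{U,μ} : bM → 𝔠_P^{(β−1)}, one transfer
  have h1 : ∀ μ, HasMaj bM (cNormR R₀ H₀ blkPX hG.lenle (β - 1)) (Φ ∘ₗ (Ddν ∘ₗ (G0 ∘ₗ Dds μ)))
      (fun a b => Bi2 * g.L * Real.exp (-((δ₀ - α * δ) * g.dist a b))) := fun μ =>
    hasMaj_cNormR_of_ofBlocks_rpow_lenInv hG hF hBi2 (h45 μ)
  -- each J_μ : bH → bM (the one length moved into the target)
  have h2 : ∀ μ, HasMaj bH bM (J μ) (fun a b => CJ * Real.exp (-(δJ * g.dist a b))) := fun μ =>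
    hasMaj_lenInv_of_len hG (hJ μ)
  -- one composition per μ, the row sum spent on J_μ
  have h3 : ∀ μ ∈ (Finset.univ : Finset P), HasMaj bH (cNormR R₀ H₀ blkPX hG.lenle (β - 1))
      ((Φ ∘ₗ (Ddν ∘ₗ (G0 ∘ₗ Dds μ))) ∘ₗ J μ) (fun a b => κ₀ * (Bi2 * L₀) * CJ * c * Real.exp (-(δ₃ * g.dist a b))) := by
    intro μ _
    have hcomp := hasMaj_comp_exp_mirror hsym htri hG.dnn hrow (mul_nonneg hBi2 hL0) hCJ hδ₃ hδ₃0 hδ₃J (h1 μ) (h2 μ)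
    refine hcomp.mono fun a b => ?_
    have hκM : bM.κ = bHX.κ := rfl
    rw [hκM, toB6_dist]
    have hE : 0 ≤ Real.exp (-(δ₃ * g.dist a b)) := Real.exp_nonneg _
    have hk1 : bHX.κ * (Bi2 * g.L) * CJ * c ≤ κ₀ * (Bi2 * L₀) * CJ * c :=
      mul_le_mul_of_nonneg_right (mul_le_mul_of_nonneg_right
        (mul_le_mul hκ (mul_le_mul_of_nonneg_left hL₀ hBi2) (mul_nonneg hBi2 hL0) (le_trans bHX.κ_nonneg hκ)) hCJ) hc
    exact mul_le_mul_of_nonneg_right hk1 hE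
  -- the kinematic rewriting and the sum over μ
  have heq : (Φ ∘ₗ Ddν ∘ₗ G0) ∘ₗ Dv = ∑ μ, (Φ ∘ₗ (Ddν ∘ₗ (G0 ∘ₗ Dds μ))) ∘ₗ J μ := by
    rw [comp_dv_eq_fsum hDv (Φ ∘ₗ Ddν ∘ₗ G0)]
    rfl
  rw [heq]
  refine (hasMaj_fsum_const _ _ _ h3).mono fun a b => ?_
  rw [Finset.card_univ]
  calc (Fintype.card P : ℝ) * (κ₀ * (Bi2 * L₀) * CJ * c * Real.exp (-(δ₃ * g.dist a b)))
      = (Fintype.card P : ℝ) * (κ₀ * (Bi2 * L₀) * CJ * c) * Real.exp (-(δ₃ * g.dist a b)) := by ring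
    _ ≤ BdX * Real.exp (-(δ₃ * g.dist a b)) := mul_le_mul_of_nonneg_right hBdX (Real.exp_nonneg _)

/-- ★★ **THE SAME WITH A NO-LENGTH J-LETTER, THE SCALAR SOURCE READ WITH THE WEIGHT (Lʲη)⁻¹** (the adapter form for a supplier's kinematic letter
`J_μ : b_W → bHX` with `C_J·e^{−δ_J d}` between flat input classes at one exponent): Φ∘∇_ν∘G₀∘D_U from `b_W` rescaled by (Lʲη)⁻¹ into 𝔠_P^{(β−1)} has
`BdX·e^{−δ₃d}` for `BdX ≥ |P|·(κ·(Bi2·L₀)·(C_J·L₀)·c)`, `0 ≤ δ₃ ≤ δ₀ − αδ`, `δ₃ + σ ≤ δ_J − αδ` (two transfers: one for (3.45)'s output power, one for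
the source weight). [cite: Balaban1985BackgroundPropagators, Thm 3.3 (3.45) p.398 + p.398 (remarks after (3.47)) + (3.3) p.390 + pp.421–423; Balaban1984PropagatorsII, (2.51)–(2.56) pp.232–233 + Lemma 2.1 (2.60)–(2.61) p.234] -/
theorem pXdDH_of_h45m_noLen (hG : GeoOK g) {σ c : ℝ} (hrow : RowSum (toB6 g R₀ H₀) σ c) {dF : ℕ} {δ α L₀ : ℝ}
    (hF : Facts347 g R₀ H₀ dF δ α L₀)
    {bW : BlockNorm (toB6 g R₀ H₀) (W → ℝ)} {bHX : BlockNorm (toB6 g R₀ H₀) (X → ℝ)} {blkPX : PX → g.Site}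
    {G0 Ddν : Module.End ℝ (X → ℝ)} {Dds : P → Module.End ℝ (X → ℝ)} {Φ : (X → ℝ) →ₗ[ℝ] (PX → ℝ)}
    {J : P → (W → ℝ) →ₗ[ℝ] (X → ℝ)} {Dv : (W → ℝ) →ₗ[ℝ] (X → ℝ)} {β Bi2 δ₀ CJ δJ κ₀ BdX δ₃ : ℝ}
    (hBi2 : 0 ≤ Bi2) (hCJ : 0 ≤ CJ) (hc : 0 ≤ c) (hκ : bHX.κ ≤ κ₀)
    (hδ₃ : 0 ≤ δ₃) (hδ₃0 : δ₃ ≤ δ₀ - α * δ) (hδ₃J : δ₃ + σ ≤ δJ - α * δ)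
    (hBdX : (Fintype.card P : ℝ) * (κ₀ * (Bi2 * L₀) * (CJ * L₀) * c) ≤ BdX)
    (hDv : Dv = ∑ μ, Dds μ ∘ₗ J μ)
    (h45 : ∀ μ, HasMaj bHX (BlockNorm.ofBlocks (toB6 g R₀ H₀) blkPX) (Φ ∘ₗ (Ddν ∘ₗ (G0 ∘ₗ Dds μ)))
      (fun a b => Bi2 * g.len a ^ (-β) * Real.exp (-(δ₀ * g.dist a b))))
    (hJ0 : ∀ μ, HasMaj bW bHX (J μ) (fun a b => CJ * Real.exp (-(δJ * g.dist a b)))) :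
    HasMaj (weightNorm bW (fun y => (g.len y)⁻¹) (fun y => inv_nonneg.mpr (hG.lenle y)))
      (cNormR R₀ H₀ blkPX hG.lenle (β - 1)) ((Φ ∘ₗ Ddν ∘ₗ G0) ∘ₗ Dv)
      (fun a b => BdX * Real.exp (-(δ₃ * g.dist a b))) := by
  have hL0 : 0 ≤ g.L := le_trans zero_le_one hF.one_le_L
  have hL₀0 : 0 ≤ L₀ := le_trans hL0 hF.L_le
  have hκ₀ : 0 ≤ κ₀ := le_trans bHX.κ_nonneg hκ
  -- the with-length letter from the no-length one, constant C_J·L, rate δ_J − αδ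
  have hJ : ∀ μ, HasMaj (weightNorm bW (fun y => (g.len y)⁻¹) (fun y => inv_nonneg.mpr (hG.lenle y))) bHX (J μ)
      (fun a b => (CJ * g.L) * g.len a * Real.exp (-((δJ - α * δ) * g.dist a b))) := fun μ =>
    hasMaj_len_of_lenInvSource hG hF hCJ (hJ0 μ)
  have hBdX' : (Fintype.card P : ℝ) * (κ₀ * (Bi2 * L₀) * (CJ * g.L) * c) ≤ BdX := by
    refine le_trans (mul_le_mul_of_nonneg_left ?_ (Nat.cast_nonneg _)) hBdX
    refine mul_le_mul_of_nonneg_right ?_ hc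
    exact mul_le_mul_of_nonneg_left (mul_le_mul_of_nonneg_left hF.L_le hCJ) (mul_nonneg hκ₀ (mul_nonneg hBi2 hL₀0))
  exact pXdDH_of_h45m hG hrow hF hBi2 (mul_nonneg hCJ hL0) hc hκ hδ₃ hδ₃0 hδ₃J hBdX' hDv h45 hJ

/-! ## §2 ★★ The field shape of `Thm33G0DirX.pXdDH` from the schema `Thm33G0Dir`; the whole face -/

section Schema

variable {B : B9.Backgrounds} {Y Z PY : Type} [Fintype X]

/-- ★★ **THE FIELD `Thm33G0DirX.pXdDH` FROM THE SCHEMA `Thm33G0Dir` (ITS (3.45) MEMBERS `h45m`), THE KINEMATIC DECOMPOSITION AND THE J-LETTERS ALONG AN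
EXPONENT SCHEDULE ε(β)**: for every ν and every β ∈ [0,1), Φ^X_β∘∇_{U,ν}∘G₀∘D_U : bH → 𝔠_P^{(β−1)} with `BdX β·e^{−δ₃d}`, provided `0 < ε β ≤ 1`, the J-letters
map `bH` into `bHX (β + ε β)` with one length (`hJ`), every `bHX γ` cuts at cost ≦ κ₀, `Bi2 ≥ 0` on the range used, `BdX β ≥ |P|·(κ₀·(Bi2 (ε β) β·L₀)·C_J·c)`,
`0 ≤ δ₃ ≤ δ₀ − αδ`, `δ₃ + σ ≤ δ_J`.  The TYPE of the conclusion is the `pXdDH` field of `B9Thm312WholeStepDirFrom3131.Thm33G0DirX 𝔬 𝔭 Dd R₀ H₀ hlen bH Bx0 BdX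
δ₀′ δ₃ U` (any `Bx0`, `δ₀′`). [cite: Balaban1985BackgroundPropagators, Thm 3.3 (3.45) p.398 + p.398 (remarks after (3.47)) + (3.3) p.390 + pp.421–423; Balaban1984PropagatorsII, (2.51)–(2.56) pp.232–233 + Lemma 2.1 (2.60)–(2.61) p.234] -/
theorem pXdDH_of_thm33G0Dir (hG : GeoOK g) {σ c : ℝ} (hrow : RowSum (toB6 g R₀ H₀) σ c) {dF : ℕ} {δ α L₀ : ℝ}
    (hF : Facts347 g R₀ H₀ dF δ α L₀)
    {𝔬 : Ops g B X Y Z W} {𝔭 : HolderProbes g B X Y PX PY} {Dd Dds : B.Cfg → P → Module.End ℝ (X → ℝ)}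
    {bHX : ℝ → BlockNorm (toB6 g R₀ H₀) (X → ℝ)} {B₀ δ₀ : ℝ} {Bh Bi : ℝ → ℝ} {Bi2 : ℝ → ℝ → ℝ} {U : B.Cfg}
    (h33 : Thm33G0Dir 𝔬 𝔭 Dd Dds R₀ H₀ bHX B₀ Bh Bi Bi2 δ₀ U)
    (hlen : ∀ y : g.Site, 0 ≤ g.len y) {bH : BlockNorm (toB6 g R₀ H₀) (W → ℝ)} {J : P → (W → ℝ) →ₗ[ℝ] (X → ℝ)}
    (ε : ℝ → ℝ) (hε : ∀ β, 0 ≤ β → β < 1 → 0 < ε β ∧ ε β ≤ 1) {CJ δJ κ₀ δ₃ : ℝ} {BdX : ℝ → ℝ}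
    (hBi2 : ∀ e b, 0 < e → e ≤ 1 → 0 ≤ b → b < 1 → 0 ≤ Bi2 e b) (hCJ : 0 ≤ CJ) (hc : 0 ≤ c) (hκ : ∀ γ, (bHX γ).κ ≤ κ₀)
    (hδ₃ : 0 ≤ δ₃) (hδ₃0 : δ₃ ≤ δ₀ - α * δ) (hδ₃J : δ₃ + σ ≤ δJ)
    (hBdX : ∀ β, 0 ≤ β → β < 1 → (Fintype.card P : ℝ) * (κ₀ * (Bi2 (ε β) β * L₀) * CJ * c) ≤ BdX β)
    (hDv : 𝔬.Dv U = ∑ μ, Dds U μ ∘ₗ J μ)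
    (hJ : ∀ β, 0 ≤ β → β < 1 → ∀ μ, HasMaj bH (bHX (β + ε β)) (J μ)
      (fun a b => CJ * g.len a * Real.exp (-(δJ * g.dist a b)))) :
    ∀ (ν : P) (β : ℝ), 0 ≤ β → β < 1 → HasMaj bH (cNormR R₀ H₀ 𝔭.blkPX hlen (β - 1))
      ((𝔭.ΦX U β ∘ₗ Dd U ν ∘ₗ 𝔬.G0 U) ∘ₗ 𝔬.Dv U) (fun a b => BdX β * Real.exp (-(δ₃ * g.dist a b))) := by
  intro ν β hβ0 hβ1
  obtain ⟨hε0, hε1⟩ := hε β hβ0 hβ1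
  exact pXdDH_of_h45m hG hrow hF (hBi2 (ε β) β hε0 hε1 hβ0 hβ1) hCJ hc (hκ (β + ε β)) hδ₃ hδ₃0 hδ₃J (hBdX β hβ0 hβ1) hDv
    (fun μ => h33.h45m (ν, μ) (ε β) β hε0 hε1 hβ0 hβ1) (hJ β hβ0 hβ1)

/-- ★ **THE SCHEDULE ε β = 1 − β: THE J-LETTERS READ AT THE SINGLE INPUT EXPONENT 1** (LOCATED REMARK X1: one source norm `bH` for all β forces one target
class for the J-letters; with ε = 1 − β it is `bHX 1`, and print's B′₀(1 − β, β) → ∞ as β → 1 is carried by `BdX β`).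
[cite: Balaban1985BackgroundPropagators, Thm 3.3 (3.45) p.398 (B′₀(ε,β) → ∞ if ε → 0 or β → 1) + (3.3) p.390 + pp.421–423; Balaban1984PropagatorsII, (2.51)–(2.56) pp.232–233 + Lemma 2.1 (2.60)–(2.61) p.234] -/
theorem pXdDH_of_thm33G0Dir_one (hG : GeoOK g) {σ c : ℝ} (hrow : RowSum (toB6 g R₀ H₀) σ c) {dF : ℕ} {δ α L₀ : ℝ}
    (hF : Facts347 g R₀ H₀ dF δ α L₀)
    {𝔬 : Ops g B X Y Z W} {𝔭 : HolderProbes g B X Y PX PY} {Dd Dds : B.Cfg → P → Module.End ℝ (X → ℝ)}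
    {bHX : ℝ → BlockNorm (toB6 g R₀ H₀) (X → ℝ)} {B₀ δ₀ : ℝ} {Bh Bi : ℝ → ℝ} {Bi2 : ℝ → ℝ → ℝ} {U : B.Cfg}
    (h33 : Thm33G0Dir 𝔬 𝔭 Dd Dds R₀ H₀ bHX B₀ Bh Bi Bi2 δ₀ U)
    (hlen : ∀ y : g.Site, 0 ≤ g.len y) {bH : BlockNorm (toB6 g R₀ H₀) (W → ℝ)} {J : P → (W → ℝ) →ₗ[ℝ] (X → ℝ)}
    {CJ δJ κ₀ δ₃ : ℝ} {BdX : ℝ → ℝ}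
    (hBi2 : ∀ e b, 0 < e → e ≤ 1 → 0 ≤ b → b < 1 → 0 ≤ Bi2 e b) (hCJ : 0 ≤ CJ) (hc : 0 ≤ c) (hκ : ∀ γ, (bHX γ).κ ≤ κ₀)
    (hδ₃ : 0 ≤ δ₃) (hδ₃0 : δ₃ ≤ δ₀ - α * δ) (hδ₃J : δ₃ + σ ≤ δJ)
    (hBdX : ∀ β, 0 ≤ β → β < 1 → (Fintype.card P : ℝ) * (κ₀ * (Bi2 (1 - β) β * L₀) * CJ * c) ≤ BdX β)
    (hDv : 𝔬.Dv U = ∑ μ, Dds U μ ∘ₗ J μ)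
    (hJ1 : ∀ μ, HasMaj bH (bHX 1) (J μ) (fun a b => CJ * g.len a * Real.exp (-(δJ * g.dist a b)))) :
    ∀ (ν : P) (β : ℝ), 0 ≤ β → β < 1 → HasMaj bH (cNormR R₀ H₀ 𝔭.blkPX hlen (β - 1))
      ((𝔭.ΦX U β ∘ₗ Dd U ν ∘ₗ 𝔬.G0 U) ∘ₗ 𝔬.Dv U) (fun a b => BdX β * Real.exp (-(δ₃ * g.dist a b))) := by
  refine pXdDH_of_thm33G0Dir hG hrow hF h33 hlen (fun β => 1 - β) (fun β hβ0 hβ1 => ⟨by linarith, by linarith⟩)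
    hBi2 hCJ hc hκ hδ₃ hδ₃0 hδ₃J hBdX hDv fun β _ _ μ => ?_
  have e : β + (1 - β) = 1 := by ring
  rw [e]
  exact hJ1 μ

/-- ★★ **THE FIELD `Thm33G0DirX.pXdDH` WITH THE SCALAR CLASS PINNED TO A FLAT SITE CLASS RESCALED BY (Lʲη)⁻¹ AND NO-LENGTH J-LETTERS** (the shape a
supplier at flat input norms provides: `J_μ : b_W → bHX (β + ε β)` with `C_J·e^{−δ_J d}` along the schedule ε): for `bH := b_W` rescaled by (Lʲη)⁻¹ the
field holds with `BdX β ≥ |P|·(κ₀·(Bi2 (ε β) β·L₀)·(C_J·L₀)·c)`, `0 ≤ δ₃ ≤ δ₀ − αδ`, `δ₃ + σ ≤ δ_J − αδ`.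
[cite: Balaban1985BackgroundPropagators, Thm 3.3 (3.45) p.398 + p.398 (remarks after (3.47)) + (3.3) p.390 + pp.421–423; Balaban1984PropagatorsII, (2.51)–(2.56) pp.232–233 + Lemma 2.1 (2.60)–(2.61) p.234] -/
theorem pXdDH_of_thm33G0Dir_noLen (hG : GeoOK g) {σ c : ℝ} (hrow : RowSum (toB6 g R₀ H₀) σ c) {dF : ℕ} {δ α L₀ : ℝ}
    (hF : Facts347 g R₀ H₀ dF δ α L₀)
    {𝔬 : Ops g B X Y Z W} {𝔭 : HolderProbes g B X Y PX PY} {Dd Dds : B.Cfg → P → Module.End ℝ (X → ℝ)}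
    {bHX : ℝ → BlockNorm (toB6 g R₀ H₀) (X → ℝ)} {B₀ δ₀ : ℝ} {Bh Bi : ℝ → ℝ} {Bi2 : ℝ → ℝ → ℝ} {U : B.Cfg}
    (h33 : Thm33G0Dir 𝔬 𝔭 Dd Dds R₀ H₀ bHX B₀ Bh Bi Bi2 δ₀ U)
    (hlen : ∀ y : g.Site, 0 ≤ g.len y) {bW : BlockNorm (toB6 g R₀ H₀) (W → ℝ)} {J : P → (W → ℝ) →ₗ[ℝ] (X → ℝ)}
    (ε : ℝ → ℝ) (hε : ∀ β, 0 ≤ β → β < 1 → 0 < ε β ∧ ε β ≤ 1) {CJ δJ κ₀ δ₃ : ℝ} {BdX : ℝ → ℝ}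
    (hBi2 : ∀ e b, 0 < e → e ≤ 1 → 0 ≤ b → b < 1 → 0 ≤ Bi2 e b) (hCJ : 0 ≤ CJ) (hc : 0 ≤ c) (hκ : ∀ γ, (bHX γ).κ ≤ κ₀)
    (hδ₃ : 0 ≤ δ₃) (hδ₃0 : δ₃ ≤ δ₀ - α * δ) (hδ₃J : δ₃ + σ ≤ δJ - α * δ)
    (hBdX : ∀ β, 0 ≤ β → β < 1 → (Fintype.card P : ℝ) * (κ₀ * (Bi2 (ε β) β * L₀) * (CJ * L₀) * c) ≤ BdX β)
    (hDv : 𝔬.Dv U = ∑ μ, Dds U μ ∘ₗ J μ)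
    (hJ0 : ∀ β, 0 ≤ β → β < 1 → ∀ μ, HasMaj bW (bHX (β + ε β)) (J μ)
      (fun a b => CJ * Real.exp (-(δJ * g.dist a b)))) :
    ∀ (ν : P) (β : ℝ), 0 ≤ β → β < 1 →
      HasMaj (weightNorm bW (fun y => (g.len y)⁻¹) (fun y => inv_nonneg.mpr (hlen y))) (cNormR R₀ H₀ 𝔭.blkPX hlen (β - 1))
        ((𝔭.ΦX U β ∘ₗ Dd U ν ∘ₗ 𝔬.G0 U) ∘ₗ 𝔬.Dv U) (fun a b => BdX β * Real.exp (-(δ₃ * g.dist a b))) := by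
  intro ν β hβ0 hβ1
  obtain ⟨hε0, hε1⟩ := hε β hβ0 hβ1
  exact pXdDH_of_h45m_noLen hG hrow hF (hBi2 (ε β) β hε0 hε1 hβ0 hβ1) hCJ hc (hκ (β + ε β)) hδ₃ hδ₃0 hδ₃J (hBdX β hβ0 hβ1) hDv
    (fun μ => h33.h45m (ν, μ) (ε β) β hε0 hε1 hβ0 hβ1) (hJ0 β hβ0 hβ1)

/-- ★★ **THE WHOLE W-c FACE `Thm33G0DirX` FROM ITS TWO SUPPLIES**: the zeroth-order probe `pX0` (supplied elsewhere — at node00-def-Y's cut probe carrier by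
`B9Thm33G0ProbeZeroAtCutPins.pX0_of_pins`; here a hypothesis of the field's own shape) and `pXdDH` from `Thm33G0Dir` + the kinematic decomposition + the
J-letters along a schedule ε (`pXdDH_of_thm33G0Dir`). [cite: Balaban1985BackgroundPropagators, Thm 3.3 p.399 + (3.42)–(3.45) pp.397–398 + (3.3) p.390 + pp.421–423; Balaban1984PropagatorsII, (2.51)–(2.56) pp.232–233 + Lemma 2.1 (2.60)–(2.61) p.234] -/
theorem thm33G0DirX_of_thm33G0Dir (hG : GeoOK g) {σ c : ℝ} (hrow : RowSum (toB6 g R₀ H₀) σ c) {dF : ℕ} {δ α L₀ : ℝ}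
    (hF : Facts347 g R₀ H₀ dF δ α L₀)
    {𝔬 : Ops g B X Y Z W} {𝔭 : HolderProbes g B X Y PX PY} {Dd Dds : B.Cfg → P → Module.End ℝ (X → ℝ)}
    {bHX : ℝ → BlockNorm (toB6 g R₀ H₀) (X → ℝ)} {B₀ δ₀ : ℝ} {Bh Bi : ℝ → ℝ} {Bi2 : ℝ → ℝ → ℝ} {U : B.Cfg}
    (h33 : Thm33G0Dir 𝔬 𝔭 Dd Dds R₀ H₀ bHX B₀ Bh Bi Bi2 δ₀ U)
    (hlen : ∀ y : g.Site, 0 ≤ g.len y) {bH : BlockNorm (toB6 g R₀ H₀) (W → ℝ)} {J : P → (W → ℝ) →ₗ[ℝ] (X → ℝ)}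
    (ε : ℝ → ℝ) (hε : ∀ β, 0 ≤ β → β < 1 → 0 < ε β ∧ ε β ≤ 1) {CJ δJ κ₀ δ₃ δ₀' : ℝ} {Bx0 BdX : ℝ → ℝ}
    (hBi2 : ∀ e b, 0 < e → e ≤ 1 → 0 ≤ b → b < 1 → 0 ≤ Bi2 e b) (hCJ : 0 ≤ CJ) (hc : 0 ≤ c) (hκ : ∀ γ, (bHX γ).κ ≤ κ₀)
    (hδ₃ : 0 ≤ δ₃) (hδ₃0 : δ₃ ≤ δ₀ - α * δ) (hδ₃J : δ₃ + σ ≤ δJ)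
    (hBdX : ∀ β, 0 ≤ β → β < 1 → (Fintype.card P : ℝ) * (κ₀ * (Bi2 (ε β) β * L₀) * CJ * c) ≤ BdX β)
    (hDv : 𝔬.Dv U = ∑ μ, Dds U μ ∘ₗ J μ)
    (hJ : ∀ β, 0 ≤ β → β < 1 → ∀ μ, HasMaj bH (bHX (β + ε β)) (J μ)
      (fun a b => CJ * g.len a * Real.exp (-(δJ * g.dist a b))))
    (hpX0 : ∀ β : ℝ, 0 ≤ β → β < 1 → HasMaj (cNormR R₀ H₀ 𝔬.blk hlen 0) (cNormR R₀ H₀ 𝔭.blkPX hlen (β - 2))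
      (𝔭.ΦX U β ∘ₗ 𝔬.G0 U) (fun a b => Bx0 β * Real.exp (-(δ₀' * g.dist a b)))) :
    Thm33G0DirX 𝔬 𝔭 Dd R₀ H₀ hlen bH Bx0 BdX δ₀' δ₃ U :=
  ⟨hpX0, pXdDH_of_thm33G0Dir hG hrow hF h33 hlen ε hε hBi2 hCJ hc hκ hδ₃ hδ₃0 hδ₃J hBdX hDv hJ⟩

end Schema

end

end Literature.MathematicalPhysics.QuantumFieldTheory.Balaban1983to89.B9Thm33G0DirXHolderFromDds
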